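import Literature.Computability.AlgebraicComplexity.IK2020TableauLiftingRightPart
import Mathlib.Logic.Relation
import HarnessLib

/-!
# Ikenmeyer–Kandasamy 2020, §15 and §17: the left part of the lifted tableau (even `D`)

References: C. Ikenmeyer, U. Kandasamy, "Implementing geometric complexity theory: on the
separation of orbit closures via symmetries", STOC 2020 / arXiv:1911.03990 (bib key
`IkenmeyerKandasamy2019`), §15 "Construction of `leftpart(T)` for even `D`" (TeX L1727–1925;
chunk p0021.txt:L80–p0022 of the held text `paper:arxiv-1911.03990`) and §17 "Proof of the Tableau
Lifting Theorem for even `D`" (TeX L2080–2400; chunks p0024–p0026).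

Brick E2 of the multi-seat program for the named fact `IK2020_thm_13_1`
(`AC/IK20HighestWeightVectors.lean`; route note `HOME/bip/NOTE-t08g4-IK2020Thm131-route.md`), on
top of bricks E1 (`AC/IK2020TableauLiftingAlphabet.lean`) and E3
(`AC/IK2020TableauLiftingRightPart.lean`, imported for the shared symbol lemma
`LiftSym.name_eq_name_iff`). Definitions with bodies and proved lemmas only; no named fact; net
debt 0. Honest framing: bookkeeping of a published proof; VP ≠ VNP is NOT proved and nothing here
is progress on it.

## Rendering

The columns of `leftpart(T)` are indexed by the vertices of the hypergraphs `H^{(i)}`, `i ∈ I`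
(§15, eq. (15.1) 'EVENeq:leftpartmadefromblocks': "`leftpart(T) := ∑_{i ∈ I} ∑_{e ∈ E_Block^{(i)}}
B̌_e` … the number of columns in `leftpart(T)` is equal to the total number of vertices"). A
hypergraph with `n_i` block edges of size `D` has the vertex set `Fin n_i × Fin D`, vertex
`v = (k, t)` lying in the block edge `k(v) = k`; the column type is
`IK2020.LCol m D n = Σ i, Fin (n i) × Fin D`. What §§15–17 USE of the hypergraphs of §14 is
recorded in function form as `IK2020.LinkData` (§A): the name-edge index `ℓ(v)` (§15, TeX
L1770–1778), name edges of size in `[1, D-1]` partitioning the vertices (Def. 14.1 (4)),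
connectivity through common block or name edges (Def. 14.1 (1)), the link vertex `ζ^{(i)}` with a
second vertex `ξ^{(i)}` in the same name edge and block edge (Def. 14.1 (6); §17, proof of Claim
29), `|E_Name| - |E_Block| = ϱ_i` (Def. 14.1 (5), built into the type `Fin (n_i + ϱ_i)` of name-edge
indices), and the distinguished letter `h ∈ I` (§15: "Let `h` denote the smallest number in `I`";
only `h ∈ I` is ever used). The normalisations `ℓ(ζ^{(i)}) = 1 = k(ζ^{(i)})` (eqs. (15.2), (15.3))
are notational; we write `ℓ(ζ^{(i)})`, `k(ζ^{(h)})` where print writes `1`. Brick E2h constructs a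
`LinkData` from the chain hypergraphs `IK2020.Chain.hyper` (Prop. 14.2).

## Contents

* §A `LinkData` and **Claim 26 in function form** (`sum_sub_card_fibre`).
* §B the columns `B_v` (`colB`, eqs. (15.4)/(15.5) 'EVENeq:iBv'/'EVENeq:jBv') and
  **`B̌ = leftpart(T)`** (`leftpart`): row `j` of `B̌` is row `j` of `B` with the entries in the
  columns of `ζ^{(j)}` and `ζ^{(h)}` exchanged (`rowPerm`; §15 "From `B` to `B̌`": "`B̌_{ζ^{(i)}}`
  arises from `B_{ζ^{(i)}}` by switching the `i`-th entry with the `i`-th entry in `B_{ζ^{(h)}}`"),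
  with the entrywise description eqs. (15.6)–(15.12) as lemmas (Claim 23, `leftpart_of_not_isLink`,
  `leftpart_linkCol_self`, `leftpart_linkCol_h₀`, `leftpart_linkCol_of_ne`).
* §C contents (Claims 25 and 28): `i_ℓ` occurs in `leftpart(T)` as often as there are vertices `v`
  with `ℓ(v) = ℓ` (`lcount_name`), `j_k^i` occurs exactly `D` times (`lcount_block`); and part (3),
  left half: under `φ(i_ℓ) = i`, `φ(j_k^i) = j` every column of `leftpart(φ T)` is `(1, …, m)ᵀ`
  (`base_leftpart`; §17, chunk p0024.txt:L19–20, via Claim 24).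
* §D §17 preliminaries for a `φ` with `leftpart(φ T)` regular: **Claim 29** (`φ(i_ℓ)` depends only
  on `i`, `phi_name_eq` / `phi_name`), `φ°` (`phi0`, eq. (17.3)), **Claim 30** (`φ°` injective on `I`,
  `phi0_injOn`), **Claim 31** (`φ(i_1^h) = φ°(i)`, `phi_block_h₀`).
* §E part (2): every block `φ(B̌_e)` is uniform (properties (I)–(III), Claims 32–36:
  `phi_leftpart_eq_ucol`), hence `leftpart(φ T)` is duplex for even `D` (`even_card_filter_leftpart`).
-/

namespace Literature.Computability.AlgebraicComplexity

namespace IK2020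

open Finset

/-! ## §A  The data of the hypergraphs `H^{(i)}` in function form -/

/-- The column index type of `leftpart(T)`: a vertex `v = (k, t)` (block edge `k`, position `t`)
of the hypergraph `H^{(i)}` with `n_i` block edges of size `D` (§15, eq. (15.1)).
[cite: IkenmeyerKandasamy2019, §15] -/
abbrev LCol (m D : ℕ) (n : Fin m → ℕ) : Type := Σ i : Fin m, Fin (n i) × Fin D

/-- **What §§15–17 use of the `(D, ϱ_i)`-hypergraphs `H^{(i)}`** (Def. 14.1, §15 TeX L1765–1784,
§17 proof of Claim 29), in function form on the vertex sets `Fin n_i × Fin D` (block edges = the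
fibres of the first projection): the name-edge index `ℓ(v) ∈ Fin (n_i + ϱ_i)` of every vertex
(Def. 14.1 (5): `|E_Name| = |E_Block| + ϱ_i`), name edges of size `≥ 1` and `< D` (Def. 14.1 (4)),
connectivity (Def. 14.1 (1): consecutive vertices of a path share a block edge or a name edge),
the link vertex `ζ^{(i)}` and a vertex `ξ^{(i)} ≠ ζ^{(i)}` "that has the same name edge and block
edge as `ζ^{(i)}`" (Def. 14.1 (6)), for the letters `i ∈ I = {i | ϱ_i ≠ 0}`; letters outside `I`
carry no hypergraph (`n_i = 0`); and the distinguished letter `h ∈ I` of §15.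
[cite: IkenmeyerKandasamy2019, Def. 14.1] -/
structure LinkData (m D : ℕ) (n ρ : Fin m → ℕ) where
  /-- `ℓ(v)`: the index of the name edge of the vertex `v` of `H^{(i)}` -/
  ℓ : (i : Fin m) → Fin (n i) × Fin D → Fin (n i + ρ i)
  /-- the link vertex `ζ^{(i)}`, `i ∈ I` -/
  ζ : (i : Fin m) → ρ i ≠ 0 → Fin (n i) × Fin D
  /-- the vertex `ξ^{(i)} ≠ ζ^{(i)}` in the name edge and the block edge of `ζ^{(i)}` -/
  ξ : (i : Fin m) → ρ i ≠ 0 → Fin (n i) × Fin D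
  /-- letters outside `I` have no hypergraph -/
  n_eq_zero : ∀ i, ρ i = 0 → n i = 0
  /-- name edges are nonempty (Def. 14.1 (4): "at least size `1`") -/
  one_le_card : ∀ i a, 1 ≤ (univ.filter fun v => ℓ i v = a).card
  /-- name edges have size `< D` (Def. 14.1 (4)) -/
  card_lt : ∀ i a, (univ.filter fun v => ℓ i v = a).card < D
  /-- `H^{(i)}` is connected (Def. 14.1 (1)) -/
  conn : ∀ i (v w : Fin (n i) × Fin D),
    Relation.ReflTransGen (fun v w : Fin (n i) × Fin D => v.1 = w.1 ∨ ℓ i v = ℓ i w) v w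
  /-- `ξ^{(i)} ≠ ζ^{(i)}` -/
  ζ_ne_ξ : ∀ i (h : ρ i ≠ 0), ζ i h ≠ ξ i h
  /-- … in the same block edge -/
  fst_ζ : ∀ i (h : ρ i ≠ 0), (ζ i h).1 = (ξ i h).1
  /-- … and the same name edge -/
  ℓ_ζ : ∀ i (h : ρ i ≠ 0), ℓ i (ζ i h) = ℓ i (ξ i h)
  /-- the distinguished letter `h ∈ I` of §15 -/
  h₀ : Fin m
  /-- `h ∈ I` -/
  ρ_h₀ : ρ h₀ ≠ 0

namespace LinkData

variable {m D : ℕ} {n ρ : Fin m → ℕ} (X : LinkData m D n ρ)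

include X in
/-- Letters outside `I` have no name symbols (`n_i + ϱ_i = 0`). [cite: IkenmeyerKandasamy2019, §15] -/
theorem ρ_ne_zero_of_fin (i : Fin m) (a : Fin (n i + ρ i)) : ρ i ≠ 0 := by
  intro h
  have := X.n_eq_zero i h
  have := a.isLt
  omega

include X in
/-- Letters outside `I` have no vertices. [cite: IkenmeyerKandasamy2019, §15] -/
theorem ρ_ne_zero_of_vertex (i : Fin m) (v : Fin (n i) × Fin D) : ρ i ≠ 0 := by
  intro h
  have := X.n_eq_zero i h
  have := v.1.isLt
  omega

/-- The vertices of `H^{(i)}` number `n_i D` (`|V| = D |E_Block|`, Def. 14.1 (3)); summing the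
sizes of the name edges gives the same (Def. 14.1 (4)). [cite: IkenmeyerKandasamy2019, §16] -/
theorem sum_card_fibre (i : Fin m) :
    ∑ a, (univ.filter fun v => X.ℓ i v = a).card = n i * D := by
  rw [← Finset.card_eq_sum_card_fiberwise fun v _ => mem_univ (X.ℓ i v)]
  simp

/-- **IK Claim 26 (printed Claim 16.5 'EVENcla:divisibility') in function form**:
`∑_ℓ (D - n(i_ℓ)) = D ϱ_i`, where `n(i_ℓ)` = the size of the name edge `ℓ` of `H^{(i)}` (chunk
p0023.txt:L28–58; the tree's hypergraph form is `Hypergraph.IsDK.sum_sub_card_names`).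
[cite: IkenmeyerKandasamy2019, §16] -/
theorem sum_sub_card_fibre (i : Fin m) :
    ∑ a, (D - (univ.filter fun v => X.ℓ i v = a).card) = D * ρ i := by
  have h2 : ∑ a, (D - (univ.filter fun v => X.ℓ i v = a).card) +
      ∑ a, (univ.filter fun v => X.ℓ i v = a).card = ∑ _a : Fin (n i + ρ i), D := by
    rw [← sum_add_distrib]
    exact sum_congr rfl fun a _ => Nat.sub_add_cancel (X.card_lt i a).le
  rw [X.sum_card_fibre, sum_const, card_univ, Fintype.card_fin, smul_eq_mul, add_mul] at h2
  rw [mul_comm]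
  omega

/-! ## §B  The columns `B_v` and the left part `B̌` -/

/-- **The column `B_v`** of the vertex `v` of `H^{(i)}` (§15 "Starting with `B`", eqs. (15.4)/(15.5)
'EVENeq:iBv'/'EVENeq:jBv', TeX L1800–1803): "the `i`-th entry of `B_v` is `i_{ℓ(v)}`; the `j`-th
entry (`j ≠ i`) of `B_v` is `j_k^i`" with `k = k(v)`. [cite: IkenmeyerKandasamy2019, §15] -/
def colB (c : LCol m D n) (r : Fin m) : LiftSym m n ρ :=
  if h : r = c.1 then LiftSym.name c.1 (X.ℓ c.1 c.2) else LiftSym.block c.1 c.2.1 r h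

/-- The column of the link vertex `ζ^{(i)}`, `i ∈ I`. [cite: IkenmeyerKandasamy2019, §15] -/
def linkCol (i : Fin m) (h : ρ i ≠ 0) : LCol m D n :=
  ⟨i, X.ζ i h⟩

/-- A column is a link column. [cite: IkenmeyerKandasamy2019, §15] -/
def IsLink (c : LCol m D n) : Prop :=
  ∃ h : ρ c.1 ≠ 0, c.2 = X.ζ c.1 h

/-- **Row `j` of `B̌` versus row `j` of `B`**: the permutation of the columns exchanging the
columns of `ζ^{(j)}` and `ζ^{(h)}` for `j ∈ I` (trivial for `j = h`), the identity for `j ∉ I`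
(§15 "From `B` to `B̌`", TeX L1806–1812: "the column `B̌_{ζ^{(i)}}` arises from `B_{ζ^{(i)}}` by
switching the `i`-th entry with the `i`-th entry in `B_{ζ^{(h)}}` … the column `B̌_{ζ^{(h)}}` arises
from `B_{ζ^{(h)}}` by switching the `i`-th entry with the `i`-th entry in `B_{ζ^{(i)}}` for all
`i ∈ I`"). [cite: IkenmeyerKandasamy2019, §15] -/
def rowPerm (r : Fin m) : Equiv.Perm (LCol m D n) :=
  if h : ρ r ≠ 0 then Equiv.swap (X.linkCol r h) (X.linkCol X.h₀ X.ρ_h₀) else 1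

/-- **`leftpart(T) = ∑_i ∑_e B̌_e`** (eq. (15.1)), column by column: the entry of row `r` of the
column of vertex `c` is the row-`r` entry of `B` in the column `rowPerm r c`.
[cite: IkenmeyerKandasamy2019, §15] -/
def leftpart (c : LCol m D n) (r : Fin m) : LiftSym m n ρ :=
  X.colB (X.rowPerm r c) r

/-- eq. (15.4): the `i`-th entry of `B_v` is `i_{ℓ(v)}`. [cite: IkenmeyerKandasamy2019, §15] -/
theorem colB_self (i : Fin m) (v : Fin (n i) × Fin D) :
    X.colB ⟨i, v⟩ i = LiftSym.name i (X.ℓ i v) := by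
  simp [colB]

/-- eq. (15.5): the `j`-th entry (`j ≠ i`) of `B_v` is `j_{k(v)}^i`. [cite: IkenmeyerKandasamy2019, §15] -/
theorem colB_of_ne {i : Fin m} {v : Fin (n i) × Fin D} {r : Fin m} (h : r ≠ i) :
    X.colB ⟨i, v⟩ r = LiftSym.block i v.1 r h := by
  simp [colB, h]

/-- The `i`-th entry of `B_{ζ^{(i)}}` is `i_{ℓ(ζ^{(i)})}` (= `i_1`, eq. (15.2)).
[cite: IkenmeyerKandasamy2019, §15] -/
theorem colB_linkCol_self (i : Fin m) (hi : ρ i ≠ 0) :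
    X.colB (X.linkCol i hi) i = LiftSym.name i (X.ℓ i (X.ζ i hi)) :=
  X.colB_self i _

/-- The `j`-th entry (`j ≠ i`) of `B_{ζ^{(i)}}` is `j^i_{k(ζ^{(i)})}` (= `j_1^i`, eq. (15.3)).
[cite: IkenmeyerKandasamy2019, §15] -/
theorem colB_linkCol_of_ne {i r : Fin m} (hi : ρ i ≠ 0) (h : r ≠ i) :
    X.colB (X.linkCol i hi) r = LiftSym.block i (X.ζ i hi).1 r h :=
  X.colB_of_ne h

/-- Every entry of `B_v` belongs to the hypergraph of `v` (`i(v) = i`). [cite: IkenmeyerKandasamy2019, §15] -/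
theorem owner_colB (c : LCol m D n) (r : Fin m) : (X.colB c r).owner = c.1 := by
  unfold colB
  split_ifs <;> rfl

/-- Under `φ(i_ℓ) = i`, `φ(j_k^i) = j` the row-`r` entry of every `B_v` becomes `r`.
[cite: IkenmeyerKandasamy2019, §17] -/
theorem base_colB (c : LCol m D n) (r : Fin m) : (X.colB c r).base = r := by
  unfold colB
  split_ifs with h
  · rw [LiftSym.base_name, h]
  · rfl

/-- The link column of `i` is a link column. [cite: IkenmeyerKandasamy2019, §15] -/
theorem isLink_linkCol (i : Fin m) (h : ρ i ≠ 0) : X.IsLink (X.linkCol i h) :=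
  ⟨h, rfl⟩

/-- A link column is the link column of its letter. [cite: IkenmeyerKandasamy2019, §15] -/
theorem IsLink.eq_linkCol {c : LCol m D n} (hc : X.IsLink c) : ∃ h : ρ c.1 ≠ 0, c = X.linkCol c.1 h := by
  obtain ⟨i, v⟩ := c
  obtain ⟨h, hc⟩ := hc
  dsimp only at h hc
  subst hc
  exact ⟨h, rfl⟩

/-- Link columns of different letters differ. [cite: IkenmeyerKandasamy2019, §15] -/
theorem linkCol_ne_linkCol {i j : Fin m} (hi : ρ i ≠ 0) (hj : ρ j ≠ 0) (hij : i ≠ j) :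
    X.linkCol i hi ≠ X.linkCol j hj :=
  fun h => hij (congrArg Sigma.fst h)

/-- The column of `ξ^{(i)}` is not a link column. [cite: IkenmeyerKandasamy2019, §15] -/
theorem not_isLink_ξ (i : Fin m) (h : ρ i ≠ 0) : ¬ X.IsLink ⟨i, X.ξ i h⟩ := by
  rintro ⟨h', he⟩
  exact X.ζ_ne_ξ i h he.symm

/-- Row `j ∉ I`: `B̌` and `B` have the same row `j`. [cite: IkenmeyerKandasamy2019, §15] -/
theorem rowPerm_of_eq_zero {r : Fin m} (hr : ρ r = 0) : X.rowPerm r = 1 := by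
  simp [rowPerm, hr]

/-- Columns of non-link vertices are not moved (Claim 23 (1): "if `ζ^{(i)} ∉ e`, then `B_e = B̌_e`";
`B̌_v := B_v` if `v` is not a link vertex). [cite: IkenmeyerKandasamy2019, Claim 15.13] -/
theorem rowPerm_of_not_isLink {c : LCol m D n} (hc : ¬ X.IsLink c) (r : Fin m) :
    X.rowPerm r c = c := by
  unfold rowPerm
  split_ifs with h
  · refine Equiv.swap_apply_of_ne_of_ne ?_ ?_ <;> rintro rfl
    · exact hc (X.isLink_linkCol r h)
    · exact hc (X.isLink_linkCol _ _)
  · rfl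

/-- Row `i ∈ I` of the column of `ζ^{(i)}` comes from the column of `ζ^{(h)}`.
[cite: IkenmeyerKandasamy2019, §15] -/
theorem rowPerm_linkCol_self (i : Fin m) (hi : ρ i ≠ 0) :
    X.rowPerm i (X.linkCol i hi) = X.linkCol X.h₀ X.ρ_h₀ := by
  unfold rowPerm
  rw [dif_pos hi, Equiv.swap_apply_left]

/-- Row `j ∈ I` of the column of `ζ^{(h)}` comes from the column of `ζ^{(j)}`.
[cite: IkenmeyerKandasamy2019, §15] -/
theorem rowPerm_linkCol_h₀ (r : Fin m) (hr : ρ r ≠ 0) :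
    X.rowPerm r (X.linkCol X.h₀ X.ρ_h₀) = X.linkCol r hr := by
  unfold rowPerm
  rw [dif_pos hr, Equiv.swap_apply_right]

/-- Rows `j ≠ i` of the column of `ζ^{(i)}`, `i ≠ h`, are not moved. [cite: IkenmeyerKandasamy2019, §15] -/
theorem rowPerm_linkCol_of_ne {i r : Fin m} (hi : ρ i ≠ 0) (hih : i ≠ X.h₀) (hri : r ≠ i) :
    X.rowPerm r (X.linkCol i hi) = X.linkCol i hi := by
  unfold rowPerm
  split_ifs with h
  · exact Equiv.swap_apply_of_ne_of_ne (X.linkCol_ne_linkCol hi h hri.symm)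
      (X.linkCol_ne_linkCol hi X.ρ_h₀ hih)
  · rfl

/-- **Claim 23 (1) / eqs. (15.6), (15.7)**: the column of a non-link vertex `v` of `H^{(i)}` in
`leftpart(T)` is `B_v` ("`B̌_v := B_v` if `v ∉ {ζ^{(i)} | i ∈ I}`").
[cite: IkenmeyerKandasamy2019, Claim 15.13] -/
theorem leftpart_of_not_isLink {c : LCol m D n} (hc : ¬ X.IsLink c) (r : Fin m) :
    X.leftpart c r = X.colB c r := by
  rw [leftpart, X.rowPerm_of_not_isLink hc]

/-- **eqs. (15.8) / (15.10)**: the `i`-th entry of `B̌_{ζ^{(i)}}` is the `i`-th entry of `B_{ζ^{(h)}}`,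
namely `i^h_{k(ζ^{(h)})}` for `i ≠ h` (Claim 23 (2): "`B_e` and `B̌_e` differ only in a single entry:
the `i`-th entry of the column `B̌_{ζ^{(i)}}` is `i_1^h` instead of `i_1`") and `h_{ℓ(ζ^{(h)})}` for
`i = h`. [cite: IkenmeyerKandasamy2019, Claim 15.13] -/
theorem leftpart_linkCol_self (i : Fin m) (hi : ρ i ≠ 0) :
    X.leftpart (X.linkCol i hi) i = X.colB (X.linkCol X.h₀ X.ρ_h₀) i := by
  rw [leftpart, X.rowPerm_linkCol_self]

/-- eq. (15.8) spelled out: for `i ∈ I`, `i ≠ h`, the `i`-th entry of `B̌_{ζ^{(i)}}` is `i^h_{k(ζ^{(h)})}`.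
[cite: IkenmeyerKandasamy2019, §15] -/
theorem leftpart_linkCol_self_of_ne (i : Fin m) (hi : ρ i ≠ 0) (hih : i ≠ X.h₀) :
    X.leftpart (X.linkCol i hi) i = LiftSym.block X.h₀ (X.ζ X.h₀ X.ρ_h₀).1 i hih := by
  rw [X.leftpart_linkCol_self, X.colB_linkCol_of_ne X.ρ_h₀ hih]

/-- eq. (15.10): the `h`-th entry of `B̌_{ζ^{(h)}}` is `h_{ℓ(ζ^{(h)})}` (= `h_1`).
[cite: IkenmeyerKandasamy2019, §15] -/
theorem leftpart_linkCol_h₀_self :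
    X.leftpart (X.linkCol X.h₀ X.ρ_h₀) X.h₀ = LiftSym.name X.h₀ (X.ℓ X.h₀ (X.ζ X.h₀ X.ρ_h₀)) := by
  rw [X.leftpart_linkCol_self, X.colB_linkCol_self]

/-- **eq. (15.11)**: "for `j ≠ h`, `j ∈ I`, the `j`-th entry of `B̌_{ζ^{(h)}}` is `j_1`" (= `j_{ℓ(ζ^{(j)})}`,
the former `j`-th entry of `B_{ζ^{(j)}}`); also true for `j = h` by eq. (15.10).
[cite: IkenmeyerKandasamy2019, §15] -/
theorem leftpart_linkCol_h₀ (r : Fin m) (hr : ρ r ≠ 0) :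
    X.leftpart (X.linkCol X.h₀ X.ρ_h₀) r = LiftSym.name r (X.ℓ r (X.ζ r hr)) := by
  rw [leftpart, X.rowPerm_linkCol_h₀ r hr, X.colB_linkCol_self]

/-- **eq. (15.12)**: "for `j ≠ h`, `j ∉ I`, the `j`-th entry of `B̌_{ζ^{(h)}}` is `j_1^h`"
(= `j^h_{k(ζ^{(h)})}`, unchanged from `B_{ζ^{(h)}}`). [cite: IkenmeyerKandasamy2019, §15] -/
theorem leftpart_linkCol_h₀_of_eq_zero (r : Fin m) (hr : ρ r = 0) (hrh : r ≠ X.h₀) :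
    X.leftpart (X.linkCol X.h₀ X.ρ_h₀) r = LiftSym.block X.h₀ (X.ζ X.h₀ X.ρ_h₀).1 r hrh := by
  rw [leftpart, X.rowPerm_of_eq_zero hr, Equiv.Perm.one_apply, X.colB_linkCol_of_ne X.ρ_h₀ hrh]

/-- **eq. (15.9)**: for `i ∈ I`, `i ≠ h`, "the `j`-th entry (`j ≠ i`) of `B̌_{ζ^{(i)}}` is
`j^i_{k(ζ^{(i)})}`" (unchanged from `B_{ζ^{(i)}}`). [cite: IkenmeyerKandasamy2019, §15] -/
theorem leftpart_linkCol_of_ne {i r : Fin m} (hi : ρ i ≠ 0) (hih : i ≠ X.h₀) (hri : r ≠ i) :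
    X.leftpart (X.linkCol i hi) r = LiftSym.block i (X.ζ i hi).1 r hri := by
  rw [leftpart, X.rowPerm_linkCol_of_ne hi hih hri, X.colB_linkCol_of_ne hi hri]

/-! ## §C  Contents of `leftpart(T)` (Claims 25, 28) and part (3) -/

/-- **Claim 24 / part (3), left half**: under the letter map `φ(i_ℓ) := i`, `φ(j_k^i) := j` every
column of `leftpart(φ(T))` "contains all entries `1, …, m`, sorted from top to bottom" (§17, chunk
p0024.txt:L19–20), i.e. its row-`r` entry is `r`. [cite: IkenmeyerKandasamy2019, §17] -/
theorem base_leftpart (c : LCol m D n) (r : Fin m) : (X.leftpart c r).base = r :=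
  X.base_colB _ r

/-- Hence `leftpart(φ(T))` is regular for this `φ`. [cite: IkenmeyerKandasamy2019, §17] -/
theorem injective_base_leftpart (c : LCol m D n) :
    Function.Injective fun r => (X.leftpart c r).base := by
  intro r r' h
  simpa only [X.base_leftpart] using h

/-- Every row of `B̌` is a permutation of the same row of `B` (proof of Claim 25: "`leftpart(T)` is
obtained by a permutation of the entries of the tableau `∑_i ∑_e B_e`"), so `B̌` and `B` have the
same content. [cite: IkenmeyerKandasamy2019, Claim 15.15] -/
theorem lcount_leftpart_eq_colB (u : LiftSym m n ρ) :
    ∑ c, (univ.filter fun r => X.leftpart c r = u).card =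
      ∑ c, (univ.filter fun r => X.colB c r = u).card := by
  simp only [Finset.card_filter]
  rw [Finset.sum_comm]
  conv_rhs => rw [Finset.sum_comm]
  refine Finset.sum_congr rfl fun r _ => ?_
  exact Equiv.sum_comp (X.rowPerm r) (fun c => if X.colB c r = u then 1 else 0)

/-- Only the columns of `H^{(i)}` carry symbols of `H^{(i)}`. [cite: IkenmeyerKandasamy2019, §15] -/
theorem lcount_colB_eq_sum_owner (u : LiftSym m n ρ) :
    ∑ c, (univ.filter fun r => X.colB c r = u).card =
      ∑ v : Fin (n u.owner) × Fin D, (univ.filter fun r => X.colB ⟨u.owner, v⟩ r = u).card := by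
  rw [Fintype.sum_sigma, Finset.sum_eq_single u.owner]
  · intro i _ hne
    refine Finset.sum_eq_zero fun v _ => ?_
    rw [Finset.card_eq_zero, Finset.filter_eq_empty_iff]
    intro r _ h
    exact hne (by rw [← h, X.owner_colB])
  · simp

/-- Two block symbols of the same hypergraph coincide iff their indices do.
[cite: IkenmeyerKandasamy2019, §13] -/
theorem _root_.Literature.Computability.AlgebraicComplexity.IK2020.LiftSym.block_eq_block_iff
    (i : Fin m) (k k' : Fin (n i)) (j j' : Fin m) (hj : j ≠ i) (hj' : j' ≠ i) :
    (LiftSym.block i k j hj : LiftSym m n ρ) = LiftSym.block i k' j' hj' ↔ k = k' ∧ j = j' := by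
  constructor
  · intro h
    have h' := eq_of_heq (Sigma.mk.inj_iff.mp (Sum.inr_injective h)).2
    simp only [Prod.mk.injEq, Subtype.mk.injEq] at h'
    exact h'
  · rintro ⟨rfl, rfl⟩
    rfl

/-- **Claim 25 (printed Claim 15.15 'EVENcla:symbolsleft')**: "for a fixed `i ∈ I`, the symbol `i_ℓ`
appears in `leftpart(T)` … exactly as many times as there are vertices `v` in `H^{(i)}` with
`ℓ(v) = ℓ`" (for `i ∉ I` there is no symbol `i_ℓ` at all). [cite: IkenmeyerKandasamy2019, Claim 15.15] -/
theorem lcount_name (i : Fin m) (a : Fin (n i + ρ i)) :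
    ∑ c, (univ.filter fun r => X.leftpart c r = LiftSym.name i a).card =
      (univ.filter fun v => X.ℓ i v = a).card := by
  rw [X.lcount_leftpart_eq_colB, X.lcount_colB_eq_sum_owner, LiftSym.owner_name, Finset.card_filter]
  refine Finset.sum_congr rfl fun v _ => ?_
  have hset : (univ.filter fun r => X.colB ⟨i, v⟩ r = LiftSym.name i a) =
      if X.ℓ i v = a then {i} else ∅ := by
    ext r
    simp only [Finset.mem_filter, Finset.mem_univ, true_and]
    by_cases hr : r = i
    · subst hr
      rw [X.colB_self, LiftSym.name_eq_name_iff]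
      split_ifs with h <;> simp [h]
    · rw [X.colB_of_ne hr]
      have hne : (LiftSym.block i v.1 r hr : LiftSym m n ρ) ≠ LiftSym.name i a := Sum.inr_ne_inl
      simp only [hne, false_iff]
      split_ifs <;> simp [hr]
  rw [hset]
  split_ifs <;> simp

/-- The block edge `k` of `H^{(i)}` has `D` vertices. [cite: IkenmeyerKandasamy2019, Def. 14.1] -/
theorem card_filter_fst_eq (i : Fin m) (k : Fin (n i)) :
    (univ.filter fun v : Fin (n i) × Fin D => v.1 = k).card = D := by
  have h : (univ.filter fun v : Fin (n i) × Fin D => v.1 = k) =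
      (univ : Finset (Fin D)).map ⟨fun t => (k, t), fun t t' h => (Prod.mk.inj h).2⟩ := by
    ext ⟨k', t⟩
    simp only [Finset.mem_filter, Finset.mem_univ, true_and, Finset.mem_map,
      Function.Embedding.coeFn_mk, Prod.mk.injEq]
    constructor
    · rintro rfl
      exact ⟨t, rfl, rfl⟩
    · rintro ⟨t', rfl, rfl⟩
      rfl
  rw [h, Finset.card_map, Finset.card_univ, Fintype.card_fin]

/-- **Claim 28 (printed Claim 16.7 'EVENcla:jki')**: "if a symbol `j_k^i` appears in `T`, then it
appears exactly `D` many times" — it occupies row `j` of the `D` columns of the block edge `k` of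
`H^{(i)}` (and does not occur in `rightpart(T)`). [cite: IkenmeyerKandasamy2019, Claim 16.7] -/
theorem lcount_block (i : Fin m) (k : Fin (n i)) (j : Fin m) (hj : j ≠ i) :
    ∑ c, (univ.filter fun r => X.leftpart c r = LiftSym.block i k j hj).card = D := by
  rw [X.lcount_leftpart_eq_colB, X.lcount_colB_eq_sum_owner, LiftSym.owner_block]
  refine Eq.trans ?_ (card_filter_fst_eq (D := D) i k)
  rw [Finset.card_filter]
  refine Finset.sum_congr rfl fun v _ => ?_
  have hset : (univ.filter fun r => X.colB ⟨i, v⟩ r = LiftSym.block i k j hj) =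
      if v.1 = k then {j} else ∅ := by
    ext r
    simp only [Finset.mem_filter, Finset.mem_univ, true_and]
    by_cases hr : r = i
    · subst hr
      rw [X.colB_self]
      have hne : (LiftSym.name r (X.ℓ r v) : LiftSym m n ρ) ≠ LiftSym.block r k j hj :=
        Sum.inl_ne_inr
      simp only [hne, false_iff]
      split_ifs <;> simp [hj.symm]
    · rw [X.colB_of_ne hr, LiftSym.block_eq_block_iff]
      split_ifs with h <;> simp [h]
  rw [hset]
  split_ifs <;> simp

/-! ## §D  §17 preliminaries: Claims 29, 30, 31 -/

/-- Two injective columns `[m] → [m]` that agree outside one row agree everywhere (both are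
bijections onto `[m]`; used in the proofs of Claims 29 and 31: "`φ(i_{ℓ(v)})` equals the one
element in `{1,…,m} ∖ {φ(j_k^i) | j ≠ i}`", chunk p0024.txt:L60–62). [cite: IkenmeyerKandasamy2019, §17] -/
theorem apply_eq_of_injective_of_forall_ne {α : Type*} [Finite α] {f g : α → α}
    (hf : Function.Injective f) (hg : Function.Injective g) (i : α)
    (h : ∀ r, r ≠ i → f r = g r) : f i = g i := by
  obtain ⟨r, hr⟩ := Finite.surjective_of_injective hg (f i)
  by_cases hri : r = i
  · subst hri
    exact hr.symm
  · rw [← h r hri] at hr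
    exact absurd (hf hr) hri

section regular

variable {φ : LiftSym m n ρ → Fin m}

/-- The vertex `ξ^{(i)}` in place of `ζ^{(i)}`, any other vertex unchanged (proof of Claim 29: "if
`ζ^{(i)} ∈ e`, then `ξ^{(i)} ∈ e`, for which we have `ℓ(ζ^{(i)}) = ℓ(ξ^{(i)})`").
[cite: IkenmeyerKandasamy2019, §17] -/
def unlink (i : Fin m) (v : Fin (n i) × Fin D) : Fin (n i) × Fin D :=
  if h : ρ i ≠ 0 then (if v = X.ζ i h then X.ξ i h else v) else v

/-- [cite: IkenmeyerKandasamy2019, §17] -/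
theorem not_isLink_unlink (i : Fin m) (v : Fin (n i) × Fin D) : ¬ X.IsLink ⟨i, X.unlink i v⟩ := by
  unfold unlink
  split_ifs with h hv
  · exact X.not_isLink_ξ i h
  · rintro ⟨h', he⟩
    exact hv he
  · rintro ⟨h', -⟩
    exact h h'

/-- [cite: IkenmeyerKandasamy2019, §17] -/
theorem fst_unlink (i : Fin m) (v : Fin (n i) × Fin D) : (X.unlink i v).1 = v.1 := by
  unfold unlink
  split_ifs with h hv
  · rw [hv, X.fst_ζ]
  · rfl
  · rfl

/-- [cite: IkenmeyerKandasamy2019, §17] -/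
theorem ℓ_unlink (i : Fin m) (v : Fin (n i) × Fin D) : X.ℓ i (X.unlink i v) = X.ℓ i v := by
  unfold unlink
  split_ifs with h hv
  · rw [hv, X.ℓ_ζ]
  · rfl
  · rfl

/-- **eq. (17.2) 'EVENeq:blockedgevarphicoincideNEW'**, non-link vertices: if `leftpart(φ T)` is
regular then `φ(i_{ℓ(v)}) = φ(i_{ℓ(w)})` for non-link vertices `v, w` of a common block edge of
`H^{(i)}` (their columns `B_v`, `B_w` agree off row `i`). [cite: IkenmeyerKandasamy2019, Claim 17.1] -/
theorem phi_name_eq_of_fst_eq_of_not_isLink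
    (hreg : ∀ c, Function.Injective fun r => φ (X.leftpart c r)) (i : Fin m)
    {v w : Fin (n i) × Fin D} (hv : ¬ X.IsLink ⟨i, v⟩) (hw : ¬ X.IsLink ⟨i, w⟩) (h : v.1 = w.1) :
    φ (LiftSym.name i (X.ℓ i v)) = φ (LiftSym.name i (X.ℓ i w)) := by
  have key := apply_eq_of_injective_of_forall_ne (hreg ⟨i, v⟩) (hreg ⟨i, w⟩) i fun r hr => by
    show φ (X.leftpart ⟨i, v⟩ r) = φ (X.leftpart ⟨i, w⟩ r)
    rw [X.leftpart_of_not_isLink hv, X.leftpart_of_not_isLink hw, X.colB_of_ne hr,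
      X.colB_of_ne hr, h]
  change φ (X.leftpart ⟨i, v⟩ i) = φ (X.leftpart ⟨i, w⟩ i) at key
  rwa [X.leftpart_of_not_isLink hv, X.leftpart_of_not_isLink hw, X.colB_self, X.colB_self] at key

/-- eq. (17.2) for all vertices of a common block edge (via `ξ^{(i)}` for the link vertex).
[cite: IkenmeyerKandasamy2019, Claim 17.1] -/
theorem phi_name_eq_of_fst_eq (hreg : ∀ c, Function.Injective fun r => φ (X.leftpart c r))
    (i : Fin m) {v w : Fin (n i) × Fin D} (h : v.1 = w.1) :
    φ (LiftSym.name i (X.ℓ i v)) = φ (LiftSym.name i (X.ℓ i w)) := by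
  rw [← X.ℓ_unlink i v, ← X.ℓ_unlink i w]
  exact X.phi_name_eq_of_fst_eq_of_not_isLink hreg i (X.not_isLink_unlink i v)
    (X.not_isLink_unlink i w) (by rw [X.fst_unlink, X.fst_unlink, h])

/-- **IK Claim 29 (printed Claim 17.1 'EVENcla:varphii')**: "If `φ(T)` is regular, then for each
`i ∈ I` we have: for every `i_ℓ` that appears in `T`, `φ(i_ℓ)` only depends on `i` and does not
depend on `ℓ`" — vertex form `φ(i_{ℓ(v)}) = φ(i_{ℓ(w)})` for all vertices `v, w` of `H^{(i)}`, by the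
connectivity of `H^{(i)}` from eqs. (17.1) (common name edge) and (17.2) (common block edge). Only
the regularity of `leftpart(φ(T))` is used. [cite: IkenmeyerKandasamy2019, Claim 17.1] -/
theorem phi_name_eq (hreg : ∀ c, Function.Injective fun r => φ (X.leftpart c r)) (i : Fin m)
    (v w : Fin (n i) × Fin D) :
    φ (LiftSym.name i (X.ℓ i v)) = φ (LiftSym.name i (X.ℓ i w)) := by
  induction X.conn i v w with
  | refl => rfl
  | tail _ hbc ih =>
    refine ih.trans ?_
    rcases hbc with h | h
    · exact X.phi_name_eq_of_fst_eq hreg i h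
    · rw [h]

/-- **`φ°`** (eq. (17.3) 'EVENeq:defvarphii': "for `i ∈ I` we define `φ°(i) := φ(i_1)`"; here
`φ(i_{ℓ(ζ^{(i)})})`), extended by the identity outside `I`. [cite: IkenmeyerKandasamy2019, §17] -/
def phi0 (φ : LiftSym m n ρ → Fin m) (i : Fin m) : Fin m :=
  if h : ρ i ≠ 0 then φ (LiftSym.name i (X.ℓ i (X.ζ i h))) else i

/-- [cite: IkenmeyerKandasamy2019, §17] -/
theorem phi0_of_ne_zero (φ : LiftSym m n ρ → Fin m) {i : Fin m} (h : ρ i ≠ 0) :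
    X.phi0 φ i = φ (LiftSym.name i (X.ℓ i (X.ζ i h))) :=
  dif_pos h

/-- Claim 29, symbol form: "`φ°(i) = φ(i_1) = φ(i_2) = …`" for every name symbol `i_ℓ` (every name
edge is nonempty, so every `i_ℓ` is some `i_{ℓ(v)}`). [cite: IkenmeyerKandasamy2019, Claim 17.1] -/
theorem phi_name (hreg : ∀ c, Function.Injective fun r => φ (X.leftpart c r)) (i : Fin m)
    (a : Fin (n i + ρ i)) : φ (LiftSym.name i a) = X.phi0 φ i := by
  have hi : ρ i ≠ 0 := X.ρ_ne_zero_of_fin i a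
  obtain ⟨v, hv⟩ : ∃ v, X.ℓ i v = a := by
    have h := X.one_le_card i a
    obtain ⟨v, hv⟩ := Finset.card_pos.mp h
    exact ⟨v, (Finset.mem_filter.mp hv).2⟩
  rw [X.phi0_of_ne_zero φ hi, ← hv]
  exact X.phi_name_eq hreg i v _

/-- The column of `ζ^{(h)}` in `leftpart(φ(T))` lists `φ°(j)` in row `j` for every `j ∈ I`
(eqs. (15.10), (15.11)). [cite: IkenmeyerKandasamy2019, §17] -/
theorem phi_leftpart_linkCol_h₀ (r : Fin m) (hr : ρ r ≠ 0) :
    φ (X.leftpart (X.linkCol X.h₀ X.ρ_h₀) r) = X.phi0 φ r := by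
  rw [X.leftpart_linkCol_h₀ r hr, X.phi0_of_ne_zero φ hr]

/-- **IK Claim 30 (printed Claim 17.2 'EVENcla:differentphiNEW')**: "Let `φ(T)` be regular. Let
`i, j ∈ I`, `i ≠ j`. Then `φ°(i) ≠ φ°(j)`" — the column `B̌_{ζ^{(h)}}` contains `i_1` in row `i` and
`j_1` in row `j`. [cite: IkenmeyerKandasamy2019, Claim 17.2] -/
theorem phi0_injOn (hreg : ∀ c, Function.Injective fun r => φ (X.leftpart c r)) :
    Set.InjOn (X.phi0 φ) {i | ρ i ≠ 0} := by
  intro i hi j hj h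
  rw [Set.mem_setOf_eq] at hi hj
  rw [← X.phi_leftpart_linkCol_h₀ i hi, ← X.phi_leftpart_linkCol_h₀ j hj] at h
  exact hreg _ h

/-- **IK Claim 31 (printed Claim 17.3 'EVENcla:droph')**: "Let `φ(T)` be regular. Let `i ∈ I`,
`i ≠ h`. Then `φ(i_1^h) = φ(i_1) = φ°(i)`" (here `i^h_{k(ζ^{(h)})}`): the columns of `ζ^{(i)}` and
`ξ^{(i)}` agree off row `i` (Claim 23 (2)). [cite: IkenmeyerKandasamy2019, Claim 17.3] -/
theorem phi_block_h₀ (hreg : ∀ c, Function.Injective fun r => φ (X.leftpart c r)) {i : Fin m}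
    (hi : ρ i ≠ 0) (hih : i ≠ X.h₀) :
    φ (LiftSym.block X.h₀ (X.ζ X.h₀ X.ρ_h₀).1 i hih) = X.phi0 φ i := by
  have key := apply_eq_of_injective_of_forall_ne (hreg (X.linkCol i hi)) (hreg ⟨i, X.ξ i hi⟩) i
    fun r hr => by
      show φ (X.leftpart (X.linkCol i hi) r) = φ (X.leftpart ⟨i, X.ξ i hi⟩ r)
      rw [X.leftpart_linkCol_of_ne hi hih hr, X.leftpart_of_not_isLink (X.not_isLink_ξ i hi),
        X.colB_of_ne hr, X.fst_ζ i hi]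
  change φ (X.leftpart (X.linkCol i hi) i) = φ (X.leftpart ⟨i, X.ξ i hi⟩ i) at key
  rw [X.leftpart_linkCol_self_of_ne i hi hih, X.leftpart_of_not_isLink (X.not_isLink_ξ i hi),
    X.colB_self, X.phi_name hreg] at key
  exact key

/-! ## §E  Part (2): every block of `leftpart(φ(T))` is uniform -/

/-- **The common column of the block `φ(B̌_e)`**, `e` the block edge `k` of `H^{(i)}`: `φ°(i)` in
row `i` (Claims 32, 35 and eq. (15.10)) and `φ(j_k^i)` in row `j ≠ i` (Claim 33).
[cite: IkenmeyerKandasamy2019, §17] -/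
def ucol (φ : LiftSym m n ρ → Fin m) (i : Fin m) (k : Fin (n i)) (r : Fin m) : Fin m :=
  if h : r = i then X.phi0 φ i else φ (LiftSym.block i k r h)

/-- Row `i` of the common column: `φ°(i)`. [cite: IkenmeyerKandasamy2019, §17] -/
theorem ucol_self (φ : LiftSym m n ρ → Fin m) (i : Fin m) (k : Fin (n i)) :
    X.ucol φ i k i = X.phi0 φ i := by
  simp [ucol]

/-- Row `j ≠ i` of the common column: `φ(j_k^i)`. [cite: IkenmeyerKandasamy2019, §17] -/
theorem ucol_of_ne (φ : LiftSym m n ρ → Fin m) {i : Fin m} (k : Fin (n i)) {r : Fin m}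
    (h : r ≠ i) : X.ucol φ i k r = φ (LiftSym.block i k r h) := by
  simp [ucol, h]

/-- **Properties (I)–(III) of §17** (Claims 32–36, TeX L2290–2400; chunks p0025.txt:L36–p0026):
if `leftpart(φ(T))` is regular then every column of the block `φ(B̌_e)` equals `ucol`: for a
non-link vertex by Claims 32/33 (property (I)); for `ζ^{(i)}`, `i ≠ h`, by Claim 34 using Claim 31
in row `i` (property (II)); for `ζ^{(h)}` by Claim 36 using eq. (15.10) in row `h`, Claim 31 in the
rows `j ∈ I ∖ {h}` and eq. (15.12) in the rows `j ∉ I` (property (III)).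
[cite: IkenmeyerKandasamy2019, §17] -/
theorem phi_leftpart_eq_ucol (hreg : ∀ c, Function.Injective fun r => φ (X.leftpart c r))
    (c : LCol m D n) (r : Fin m) : φ (X.leftpart c r) = X.ucol φ c.1 c.2.1 r := by
  obtain ⟨i, v⟩ := c
  dsimp only
  by_cases hc : X.IsLink ⟨i, v⟩
  · -- the column of a link vertex `ζ^{(i)}`
    obtain ⟨hi, hv⟩ := hc
    dsimp only at hi hv
    subst hv
    change φ (X.leftpart (X.linkCol i hi) r) = X.ucol φ i (X.ζ i hi).1 r
    by_cases hr : r = i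
    · -- row `i`
      rw [hr, X.ucol_self]
      by_cases hih : i = X.h₀
      · -- `i = h`: eq. (15.10), the entry is `h_{ℓ(ζ^{(h)})}`
        subst hih
        exact X.phi_leftpart_linkCol_h₀ (φ := φ) X.h₀ hi
      · -- `i ≠ h`: eq. (15.8) and Claim 31
        rw [X.leftpart_linkCol_self_of_ne i hi hih, X.phi_block_h₀ hreg hi hih]
    · rw [X.ucol_of_ne φ _ hr]
      by_cases hih : i = X.h₀
      · -- the column of `ζ^{(h)}`, row `r ≠ h`
        subst hih
        change φ (X.leftpart (X.linkCol X.h₀ X.ρ_h₀) r) =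
          φ (LiftSym.block X.h₀ (X.ζ X.h₀ X.ρ_h₀).1 r hr)
        by_cases hρr : ρ r = 0
        · -- `r ∉ I`, eq. (15.12): `r^h_{k(ζ^{(h)})}`
          rw [X.leftpart_linkCol_h₀_of_eq_zero r hρr hr]
        · -- `r ∈ I`, eq. (15.11): `r_{ℓ(ζ^{(r)})}`, and Claim 31 for `r`
          rw [X.phi_leftpart_linkCol_h₀ (φ := φ) r hρr, ← X.phi_block_h₀ hreg hρr hr]
      · -- the column of `ζ^{(i)}`, `i ≠ h`, row `r ≠ i`: eq. (15.9)
        rw [X.leftpart_linkCol_of_ne hi hih hr]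
  · -- a non-link column `B_v`: Claims 32 and 33
    rw [X.leftpart_of_not_isLink hc]
    by_cases hr : r = i
    · rw [hr, X.ucol_self, X.colB_self, X.phi_name hreg]
    · rw [X.ucol_of_ne φ _ hr, X.colB_of_ne hr]

/-- The columns of `leftpart(φ(T))` as functions: column `c` is `ucol` of the block edge of `c`.
[cite: IkenmeyerKandasamy2019, §17] -/
theorem phi_leftpart_funext (hreg : ∀ c, Function.Injective fun r => φ (X.leftpart c r))
    (c : LCol m D n) : (fun r => φ (X.leftpart c r)) = X.ucol φ c.1 c.2.1 :=
  funext fun r => X.phi_leftpart_eq_ucol hreg c r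

/-- The `D` columns of a block edge, as a subset of the column index type.
[cite: IkenmeyerKandasamy2019, §15] -/
theorem card_filter_block (i : Fin m) (k : Fin (n i)) :
    (univ.filter fun c : LCol m D n =>
      (⟨c.1, c.2.1⟩ : Σ j : Fin m, Fin (n j)) = ⟨i, k⟩).card = D := by
  have h : (univ.filter fun c : LCol m D n => (⟨c.1, c.2.1⟩ : Σ j : Fin m, Fin (n j)) = ⟨i, k⟩) =
      (univ : Finset (Fin D)).map ⟨fun t => (⟨i, (k, t)⟩ : LCol m D n), fun t t' h => by
        simpa using h⟩ := by
    ext ⟨i', k', t'⟩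
    simp only [Finset.mem_filter, Finset.mem_univ, true_and, Finset.mem_map,
      Function.Embedding.coeFn_mk]
    constructor
    · intro h
      obtain ⟨rfl, hk⟩ := Sigma.mk.inj_iff.mp h
      obtain rfl := eq_of_heq hk
      exact ⟨t', rfl⟩
    · rintro ⟨t, ht⟩
      obtain ⟨rfl, h2⟩ := Sigma.mk.inj_iff.mp ht
      have h3 := eq_of_heq h2
      simp only [Prod.mk.injEq] at h3
      obtain ⟨rfl, rfl⟩ := h3
      rfl
  rw [h, Finset.card_map, Finset.card_univ, Fintype.card_fin]

/-- **Part (2) of Thm. 13.1, column form** (§17, chunk p0025.txt:L22–35: "a uniform tableau with an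
even number of columns is duplex … (I)–(III) cover all cases and hence [`leftpart(φ(T))` is duplex]
by construction (EVENeq:leftpartmadefromblocks)"): for even `D`, if `leftpart(φ(T))` is regular
then every column of `leftpart(φ(T))` occurs an even number of times — a union of whole block
edges, `D` columns each. [cite: IkenmeyerKandasamy2019, Thm. 13.1] -/
theorem even_card_filter_leftpart (hD : Even D)
    (hreg : ∀ c, Function.Injective fun r => φ (X.leftpart c r)) (c : LCol m D n) :
    Even ((univ.filter fun c' : LCol m D n =>
      (fun r => φ (X.leftpart c' r)) = fun r => φ (X.leftpart c r)).card) := by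
  classical
  have h1 : (univ.filter fun c' : LCol m D n =>
      (fun r => φ (X.leftpart c' r)) = fun r => φ (X.leftpart c r)) =
      univ.filter fun c' : LCol m D n => X.ucol φ c'.1 c'.2.1 = X.ucol φ c.1 c.2.1 :=
    Finset.filter_congr fun c' _ => by
      rw [X.phi_leftpart_funext hreg c', X.phi_leftpart_funext hreg c]
  rw [h1, Finset.card_eq_sum_card_fiberwise
    (f := fun c' : LCol m D n => (⟨c'.1, c'.2.1⟩ : Σ j : Fin m, Fin (n j))) (t := univ)
    fun _ _ => Finset.mem_univ _]
  refine Finset.even_sum _ fun κ _ => ?_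
  obtain ⟨i, k⟩ := κ
  by_cases hκ : X.ucol φ i k = X.ucol φ c.1 c.2.1
  · -- the whole block edge `k` of `H^{(i)}`
    have hset : ((univ.filter fun c' : LCol m D n =>
        X.ucol φ c'.1 c'.2.1 = X.ucol φ c.1 c.2.1).filter
        fun c' => (⟨c'.1, c'.2.1⟩ : Σ j : Fin m, Fin (n j)) = ⟨i, k⟩) =
        univ.filter fun c' : LCol m D n => (⟨c'.1, c'.2.1⟩ : Σ j : Fin m, Fin (n j)) = ⟨i, k⟩ := by
      ext c'
      simp only [Finset.mem_filter, Finset.mem_univ, true_and, and_iff_right_iff_imp]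
      intro h
      obtain ⟨i', k', t'⟩ := c'
      obtain ⟨rfl, h2⟩ := Sigma.mk.inj_iff.mp h
      obtain rfl := eq_of_heq h2
      exact hκ
    rw [hset, card_filter_block]
    exact hD
  · -- no column of this block edge
    have hset : ((univ.filter fun c' : LCol m D n =>
        X.ucol φ c'.1 c'.2.1 = X.ucol φ c.1 c.2.1).filter
        fun c' => (⟨c'.1, c'.2.1⟩ : Σ j : Fin m, Fin (n j)) = ⟨i, k⟩) = ∅ := by
      rw [Finset.filter_eq_empty_iff]
      intro c' hc' h
      rw [Finset.mem_filter] at hc'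
      apply hκ
      obtain ⟨i', k', t'⟩ := c'
      obtain ⟨rfl, h2⟩ := Sigma.mk.inj_iff.mp h
      obtain rfl := eq_of_heq h2
      exact hc'.2
    rw [hset, Finset.card_empty]
    exact Even.zero

end regular

end LinkData

end IK2020

end Literature.Computability.AlgebraicComplexity
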